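import Summits.Ventures.HSemireg.ObstructionLocusLocalLemma

/-!
# Venture HSemireg — (S5) OBSTRUCTION LOCUS away from secant type, IX: the LOCAL LEMMA L1 of the SR design in the
# kernel, brick 3 — `Ann_{R/I_W}(x_k) = (m_{jk} : j ≠ k)/I_W ≅ ⊕_{j ≠ k} R/(x_j, x_k)` and the branch decomposition
# `Hom_R(I_W, R/I_W) ≅ ⊕_k ⊕_{j ≠ k} R/(x_j, x_k)·E_{kj}` (L1 (i), every `n`, every domain `K`)

HONEST FRAMING.  Companion of `ObstructionLocusLocalLemma.lean` (cell `pub-hsemireg`, track «S4-PUSH» (ii), seat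
s4-prove-2): plain commutative algebra in `R = MvPolynomial (Fin n) K`, `K` any commutative ring (a domain where
stated — e.g. `K = k[y]`, the extra-free-variables form); nothing here constructs a variety or a sheaf;
nothing here says that HC / HC_CM / HC_AV holds; no Literature fact is declared or used.  With file VIII this puts
LEMMA L1 (i) of general-structure/eng1/g2/G2-REDUCIBLE-POINT-THEOREM.md §2 — «`Hom_R(I, R/I) = ⊕_k ⊕_{j≠k} M_{kj}`,
`M_{kj} ≅ O(B_{jk})·∂_j` free of rank one over `R/(x_j, x_k)`; hence `N′_W ≅ ⊕_{j<k} ν_* N_{B_jk}`» — in the kernel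
for every `n` (paper ×2, codes ×4 for `n ≤ 7` before).  What this does for (S5): the LOCAL half of the named hypothesis
shape (H-arr) of file I (`ReduciblePointObject.HArr`) for the literal ideal sheaf `I_W` is now a theorem of the affine
model; the global half (Prop. K = Hartshorne DT Thm 2.4 + one Čech line, and sheafification/base change of L1) stays
prose, as does (H-NC).

* `cofactor₂ j k = ∏_{l ∉ {j,k}} x_l` (`= m_{jk}`, the value `E_{kj}(m_k)`), `X_mul_cofactor₂` (`x_j m_{jk} = m_k`).
* `branchMap k : R^{{j ≠ k}} → R/I_W`, `r ↦ Σ_j r_j m_{jk} mod I_W`; `range_branchMap` — **its image is EXACTLY the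
  annihilator `Ann_{R/I_W}(x_k)`** (monomial by monomial: `x_k x^a ∈ I_W` forces `x^a` to be a multiple of some
  `m_{jk}` or of `m_k`); `ker_branchMap` — **its kernel is EXACTLY `⊕_j (x_j, x_k)`** (the monomial `x^a m_{j₀k}`
  with `a_{j₀} = a_k = 0` survives in `Σ r_j m_{jk}` and has two zero coordinates, so is not in `I_W`).
* `annBranchEquiv k : Ann_{R/I_W}(x_k) ≃ₗ[R] Π_{j ≠ k} R/(x_j, x_k)` and the assembled
  **`normalModuleEquiv : Hom_R(I_W, R/I_W) ≃ₗ[R] Π_k Π_{j ≠ k} R/(x_j, x_k)`** = L1 (i): the component `(k, j)` of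
  `φ` is the class of `r_j` in any expression `φ(m_k) = Σ_j r_j m_{jk}`, i.e. the coefficient of the constant normal
  field `∂_j` of the branch `B_jk = V(x_j, x_k)` — «restrict the normal field to the branch».
References (dictionary only): G2-REDUCIBLE-POINT-THEOREM.md §2 L1 (i); EXT-NOTE.md §6.B(a).
-/

open scoped BigOperators
open MvPolynomial Finset

namespace Summit.Ventures.HSemireg.ObstructionLocus

variable {K : Type*} [CommRing K] {n : ℕ}

/-! ## The branch monomials `m_{jk}` -/

/-- `m_{jk} = ∏_{l ∉ {j, k}} x_l` (for `j ≠ k`; `= E_{kj}(m_k)`, the square-free monomial of the coordinates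
transverse to neither branch equation of `B_jk = V(x_j, x_k)`). -/
noncomputable def cofactor₂ (j k : Fin n) : MvPolynomial (Fin n) K := ∏ l ∈ (univ.erase k).erase j, X l

/-- `x_j · m_{jk} = m_k`. -/
theorem X_mul_cofactor₂ {j k : Fin n} (hjk : j ≠ k) : X j * cofactor₂ j k = (cofactor k : MvPolynomial (Fin n) K) := by
  rw [cofactor₂, cofactor, Finset.mul_prod_erase (univ.erase k) (fun l => (X l : MvPolynomial (Fin n) K))
    (mem_erase.2 ⟨hjk, mem_univ j⟩)]

/-- `(univ ∖ k) ∖ j = (univ ∖ j) ∖ k`. -/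
theorem erase_erase_comm (j k : Fin n) : (univ.erase k).erase j = (univ.erase j).erase k :=
  Finset.erase_right_comm

/-- `x_k · m_{jk} = m_j`. -/
theorem X_mul_cofactor₂' {j k : Fin n} (hjk : j ≠ k) :
    X k * cofactor₂ j k = (cofactor j : MvPolynomial (Fin n) K) := by
  rw [cofactor₂, erase_erase_comm, cofactor, Finset.mul_prod_erase (univ.erase j)
    (fun l => (X l : MvPolynomial (Fin n) K)) (mem_erase.2 ⟨hjk.symm, mem_univ k⟩)]

/-- `m_{jk}` is the monomial with exponent the indicator of `[n] ∖ {j, k}`. -/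
theorem cofactor₂_eq_monomial (j k : Fin n) :
    (cofactor₂ j k : MvPolynomial (Fin n) K)
      = monomial (Finsupp.indicator ((univ.erase k).erase j) fun _ _ => 1) 1 :=
  Literature.AlgebraicGeometry.StanleyReisner.prod_X_eq_monomial_indicator K ((univ.erase k).erase j)

/-- The indicator exponent vanishes off its set. -/
theorem indicator_apply_of_notMem {s : Finset (Fin n)} {i : Fin n} (hi : i ∉ s) :
    (Finsupp.indicator s fun _ _ => (1 : ℕ)) i = 0 := by
  rw [Finsupp.indicator_apply, dif_neg hi]

/-- The indicator exponent is `1` on its set. -/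
theorem indicator_apply_of_mem {s : Finset (Fin n)} {i : Fin n} (hi : i ∈ s) :
    (Finsupp.indicator s fun _ _ => (1 : ℕ)) i = 1 := by
  rw [Finsupp.indicator_apply, dif_pos hi]

/-! ## The branch map `β_k` and the annihilator of `x_k` -/

/-- The branch map `β_k : R^{{j : j ≠ k}} → R/I_W`, `r ↦ Σ_j r_j m_{jk} mod I_W`. -/
noncomputable def branchMap (k : Fin n) :
    ({j : Fin n // j ≠ k} → MvPolynomial (Fin n) K) →ₗ[MvPolynomial (Fin n) K]
      MvPolynomial (Fin n) K ⧸ srDesignIdeal K n :=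
  ∑ j, (LinearMap.proj j).smulRight (Ideal.Quotient.mk (srDesignIdeal K n) (cofactor₂ j.1 k))

/-- `β_k r = Σ_j r_j m_{jk} mod I_W`. -/
theorem branchMap_apply (k : Fin n) (r : {j : Fin n // j ≠ k} → MvPolynomial (Fin n) K) :
    branchMap k r = Ideal.Quotient.mk (srDesignIdeal K n) (∑ j, r j * cofactor₂ j.1 k) := by
  simp only [branchMap, LinearMap.sum_apply, LinearMap.smulRight_apply, LinearMap.proj_apply, smul_mk,
    map_sum]

/-- `β_k e_j = m_{jk} mod I_W`. -/
theorem branchMap_single (k : Fin n) (j : {j : Fin n // j ≠ k}) :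
    branchMap k (Pi.single j 1) = Ideal.Quotient.mk (srDesignIdeal K n) (cofactor₂ j.1 k) := by
  rw [branchMap_apply, Finset.sum_eq_single j]
  · simp
  · intro l _ hl; simp [hl]
  · intro h; exact absurd (mem_univ j) h

/-- `x_k` kills the image of `β_k`: `x_k m_{jk} = m_j ∈ I_W`. -/
theorem range_branchMap_le (k : Fin n) :
    LinearMap.range (branchMap (K := K) k)
      ≤ Submodule.torsionBy (MvPolynomial (Fin n) K) _ (X k : MvPolynomial (Fin n) K) := by
  rintro _ ⟨r, rfl⟩
  rw [Submodule.mem_torsionBy_iff, branchMap_apply, smul_mk, Ideal.Quotient.eq_zero_iff_mem, Finset.mul_sum]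
  refine Ideal.sum_mem _ fun j _ => ?_
  rw [mul_left_comm, X_mul_cofactor₂' j.2]
  exact Ideal.mul_mem_left _ _ (cofactor_mem j.1)

/-- A polynomial killed by `x_k` modulo `I_W` lies in `(m_{jk} : j ≠ k) + (m_k)` — monomial by monomial. -/
theorem mem_span_of_X_mul_mem {k : Fin n} {g : MvPolynomial (Fin n) K} (hg : X k * g ∈ srDesignIdeal K n) :
    g ∈ Ideal.span ((fun e => monomial e (1 : K)) ''
      ({e | ∃ j : Fin n, j ≠ k ∧ e = Finsupp.indicator ((univ.erase k).erase j) fun _ _ => 1}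
        ∪ {Finsupp.indicator (univ.erase k) fun _ _ => 1})) := by
  classical
  rw [mem_ideal_span_monomial_image]
  intro a ha
  have ha' : Finsupp.single k 1 + a ∈ (X k * g).support := by
    rw [mem_support_iff, coeff_X_mul]; exact mem_support_iff.1 ha
  obtain ⟨l, hl⟩ := mem_srDesignIdeal_iff.1 hg _ ha'
  have hsub : ∀ i, i ≠ l → i ≠ k → i ∈ a.support := by
    intro i hil hik
    have hi := hl (mem_erase.2 ⟨hil, mem_univ i⟩)
    rw [Finsupp.mem_support_iff, Finsupp.add_apply, Finsupp.single_eq_of_ne hik, zero_add] at hi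
    exact Finsupp.mem_support_iff.2 hi
  by_cases hlk : l = k
  · subst hlk
    refine ⟨_, Or.inr rfl, Literature.AlgebraicGeometry.StanleyReisner.indicator_one_le_iff.2 ?_⟩
    intro i hi
    exact hsub i (mem_erase.1 hi).1 (mem_erase.1 hi).1
  · refine ⟨_, Or.inl ⟨l, hlk, rfl⟩, Literature.AlgebraicGeometry.StanleyReisner.indicator_one_le_iff.2 ?_⟩
    intro i hi
    exact hsub i (mem_erase.1 hi).1 (mem_erase.1 (mem_erase.1 hi).2).1

/-- **`range β_k = Ann_{R/I_W}(x_k)`**: the annihilator of `x_k` in `R/I_W` is generated by the branch monomials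
`m_{jk}`, `j ≠ k`. -/
theorem range_branchMap (k : Fin n) :
    LinearMap.range (branchMap (K := K) k)
      = Submodule.torsionBy (MvPolynomial (Fin n) K) _ (X k : MvPolynomial (Fin n) K) := by
  refine le_antisymm (range_branchMap_le k) ?_
  intro u hu
  rw [Submodule.mem_torsionBy_iff] at hu
  obtain ⟨g, rfl⟩ := Ideal.Quotient.mk_surjective u
  rw [smul_mk, Ideal.Quotient.eq_zero_iff_mem] at hu
  have hg := mem_span_of_X_mul_mem hu
  -- every generator of that monomial ideal maps into `range β_k`
  refine Submodule.span_induction (p := fun f _ => Ideal.Quotient.mk (srDesignIdeal K n) f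
      ∈ LinearMap.range (branchMap (K := K) k)) ?_ ?_ ?_ ?_ hg
  · rintro _ ⟨e, he | he, rfl⟩
    · obtain ⟨j, hjk, rfl⟩ := he
      refine ⟨Pi.single ⟨j, hjk⟩ 1, ?_⟩
      rw [branchMap_single, cofactor₂_eq_monomial]
    · rw [Set.mem_singleton_iff] at he
      subst he
      dsimp only
      rw [← cofactor_eq_monomial, Ideal.Quotient.eq_zero_iff_mem.2 (cofactor_mem k)]
      exact Submodule.zero_mem _
  · rw [map_zero]; exact Submodule.zero_mem _
  · intro f g _ _ hf hg
    rw [map_add]; exact Submodule.add_mem _ hf hg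
  · intro r f _ hf
    rw [smul_eq_mul, ← smul_mk]
    exact Submodule.smul_mem _ r hf

/-! ## The kernel of `β_k` -/

/-- `(x_j, x_k) e_j ⊆ ker β_k`: `x_j m_{jk} = m_k`, `x_k m_{jk} = m_j`. -/
theorem pi_le_ker_branchMap (k : Fin n) :
    Submodule.pi Set.univ (fun j : {j : Fin n // j ≠ k} =>
        (Ideal.span {(X j.1 : MvPolynomial (Fin n) K), X k} : Submodule (MvPolynomial (Fin n) K) _))
      ≤ LinearMap.ker (branchMap (K := K) k) := by
  intro r hr
  rw [LinearMap.mem_ker, branchMap_apply, Ideal.Quotient.eq_zero_iff_mem]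
  refine Ideal.sum_mem _ fun j _ => ?_
  obtain ⟨a, b, hab⟩ := Ideal.mem_span_pair.1 (hr j (Set.mem_univ j))
  rw [← hab, add_mul, mul_assoc, mul_assoc, X_mul_cofactor₂ j.2, X_mul_cofactor₂' j.2]
  exact Ideal.add_mem _ (Ideal.mul_mem_left _ _ (cofactor_mem k)) (Ideal.mul_mem_left _ _ (cofactor_mem j.1))

/-- Monomial criterion for the branch ideal `(x_j, x_k)`. -/
theorem mem_span_X_pair_iff {j k : Fin n} {f : MvPolynomial (Fin n) K} :
    f ∈ Ideal.span {(X j : MvPolynomial (Fin n) K), X k} ↔ ∀ a ∈ f.support, a j ≠ 0 ∨ a k ≠ 0 := by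
  have h : ({(X j : MvPolynomial (Fin n) K), X k} : Set (MvPolynomial (Fin n) K))
      = (fun e => monomial e (1 : K)) '' {Finsupp.single j 1, Finsupp.single k 1} := by
    ext m
    simp [X, Set.image_pair]
  rw [h, mem_ideal_span_monomial_image]
  refine forall₂_congr fun a _ => ?_
  simp only [Set.mem_insert_iff, Set.mem_singleton_iff, exists_eq_or_imp, exists_eq_left,
    Finsupp.single_le_iff, Nat.one_le_iff_ne_zero]

/-- **`ker β_k = ⊕_j (x_j, x_k)`**: if `Σ_j r_j m_{jk} ∈ I_W` then every `r_j ∈ (x_j, x_k)`. -/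
theorem ker_branchMap (k : Fin n) :
    LinearMap.ker (branchMap (K := K) k)
      = Submodule.pi Set.univ (fun j : {j : Fin n // j ≠ k} =>
        (Ideal.span {(X j.1 : MvPolynomial (Fin n) K), X k} : Submodule (MvPolynomial (Fin n) K) _)) := by
  classical
  refine le_antisymm ?_ (pi_le_ker_branchMap k)
  intro r hr j₀ _
  rw [LinearMap.mem_ker, branchMap_apply, Ideal.Quotient.eq_zero_iff_mem] at hr
  rw [SetLike.mem_coe, mem_span_X_pair_iff]
  intro a ha
  by_contra hnot
  push Not at hnot
  obtain ⟨haj, hak⟩ := hnot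
  -- the monomial `x^a m_{j₀ k}` survives in `Σ_j r_j m_{jk}`
  set ι : {j : Fin n // j ≠ k} → (Fin n →₀ ℕ) :=
    fun j => Finsupp.indicator ((univ.erase k).erase j.1) fun _ _ => 1 with hι
  set b : Fin n →₀ ℕ := a + ι j₀ with hb
  have hcoeff : coeff b (∑ j, r j * cofactor₂ j.1 k) = coeff a (r j₀) := by
    rw [coeff_sum, Finset.sum_eq_single j₀]
    · rw [cofactor₂_eq_monomial, coeff_mul_monomial', if_pos (by rw [hb]; exact le_add_self), mul_one, hb,
        add_tsub_cancel_right]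
    · intro j _ hj
      rw [cofactor₂_eq_monomial, coeff_mul_monomial', if_neg]
      intro hle
      have h1 := hle j₀.1
      have hj₀ : j₀.1 ∈ (univ.erase k).erase j.1 :=
        mem_erase.2 ⟨fun h => hj (Subtype.ext h).symm, mem_erase.2 ⟨j₀.2, mem_univ _⟩⟩
      rw [indicator_apply_of_mem hj₀, hb, Finsupp.add_apply, haj, hι,
        indicator_apply_of_notMem (Finset.notMem_erase j₀.1 _)] at h1
      omega
    · intro h; exact absurd (mem_univ j₀) h
  have hbsupp : b ∈ (∑ j, r j * cofactor₂ j.1 k).support := by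
    rw [mem_support_iff, hcoeff]; exact mem_support_iff.1 ha
  obtain ⟨l, hl⟩ := mem_srDesignIdeal_iff.1 hr b hbsupp
  -- but `b` vanishes at the two distinct coordinates `j₀` and `k`
  have hbj : b j₀.1 = 0 := by
    rw [hb, Finsupp.add_apply, haj, hι, indicator_apply_of_notMem (Finset.notMem_erase j₀.1 _)]
  have hbk : b k = 0 := by
    rw [hb, Finsupp.add_apply, hak, hι, indicator_apply_of_notMem]
    exact fun h => Finset.notMem_erase k univ (mem_erase.1 h).2
  by_cases hlj : l = j₀.1
  · have := hl (mem_erase.2 ⟨fun h => j₀.2 (h.trans hlj).symm, mem_univ k⟩)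
    rw [Finsupp.mem_support_iff] at this
    exact this hbk
  · have := hl (mem_erase.2 ⟨fun h => hlj h.symm, mem_univ j₀.1⟩)
    rw [Finsupp.mem_support_iff] at this
    exact this hbj

/-! ## L1 (i): the branch decomposition of the normal module -/

/-- **`Ann_{R/I_W}(x_k) ≅ ⊕_{j ≠ k} R/(x_j, x_k)`** — the `k`-th summand of the normal module is free of rank one over
each branch `B_jk` through the `k`-th generator, with basis `E_{kj} : m_k ↦ m_{jk}`. -/
noncomputable def annBranchEquiv [IsDomain K] (k : Fin n) :
    Submodule.torsionBy (MvPolynomial (Fin n) K) (MvPolynomial (Fin n) K ⧸ srDesignIdeal K n)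
        (X k : MvPolynomial (Fin n) K)
      ≃ₗ[MvPolynomial (Fin n) K]
        ((j : {j : Fin n // j ≠ k}) →
          MvPolynomial (Fin n) K ⧸ Ideal.span {(X j.1 : MvPolynomial (Fin n) K), X k}) :=
  (LinearEquiv.ofEq _ _ (range_branchMap k)).symm
    ≪≫ₗ (LinearMap.quotKerEquivRange (branchMap k)).symm
    ≪≫ₗ Submodule.quotEquivOfEq _ _ (ker_branchMap k)
    ≪≫ₗ Submodule.quotientPi _

/-- The tuples killed coordinatewise by the `x_k` are the product of the annihilators. -/
noncomputable def annTuplesEquivPi :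
    annTuples K n ≃ₗ[MvPolynomial (Fin n) K]
      ((k : Fin n) → Submodule.torsionBy (MvPolynomial (Fin n) K)
        (MvPolynomial (Fin n) K ⧸ srDesignIdeal K n) (X k : MvPolynomial (Fin n) K)) where
  toFun ν k := ⟨ν.1 k, (Submodule.mem_torsionBy_iff _ _).2 (ν.2 k)⟩
  map_add' _ _ := rfl
  map_smul' _ _ := rfl
  invFun μ := ⟨fun k => (μ k).1, fun k => (Submodule.mem_torsionBy_iff _ _).1 (μ k).2⟩
  left_inv _ := rfl
  right_inv _ := rfl

variable (K n) in
/-- **LEMMA L1 (i) (every `n`, every domain `K`): the branch decomposition of the normal module of the SR design.**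
`Hom_R(I_W, R/I_W) ≃ₗ[R] Π_k Π_{j ≠ k} R/(x_j, x_k)`: an `R`-linear map `φ : I_W → R/I_W` is the same as, for each
generator `m_k` and each branch `B_jk ∋` (i.e. `j ≠ k`), a class in `R/(x_j, x_k) = 𝒪(B_jk)` — the coefficient of the
constant normal field `∂_j` of `B_jk` in `φ(m_k) = Σ_j r_j m_{jk}`.  Equivalently `N′_W = 𝓗om(I_W, 𝒪_W) ≅ ⊕_{j<k}
ν_* N_{B_jk}` on the affine model, «restrict the normal field to the branch» (G2-REDUCIBLE-POINT-THEOREM §2 L1 (i)). -/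
noncomputable def normalModuleEquiv [IsDomain K] :
    (srDesignIdeal K n →ₗ[MvPolynomial (Fin n) K] MvPolynomial (Fin n) K ⧸ srDesignIdeal K n)
      ≃ₗ[MvPolynomial (Fin n) K]
        ((k : Fin n) → (j : {j : Fin n // j ≠ k}) →
          MvPolynomial (Fin n) K ⧸ Ideal.span {(X j.1 : MvPolynomial (Fin n) K), X k}) :=
  evalGenEquiv K n ≪≫ₗ annTuplesEquivPi ≪≫ₗ LinearEquiv.piCongrRight fun k => annBranchEquiv k

/-- **The normal field `E_{kj}`** (`j ≠ k`): the `R`-linear map `I_W → R/I_W` with `m_k ↦ m_{jk}`, `m_l ↦ 0` (`l ≠ k`)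
— the constant normal field `∂_j` of the branch `B_jk`, seen on the generator `m_k` only. -/
noncomputable def normalField [IsDomain K] {j k : Fin n} (hjk : j ≠ k) :
    srDesignIdeal K n →ₗ[MvPolynomial (Fin n) K] MvPolynomial (Fin n) K ⧸ srDesignIdeal K n :=
  homOfTuple (Pi.single k (Ideal.Quotient.mk (srDesignIdeal K n) (cofactor₂ j k))) (by
    intro l
    by_cases hl : l = k
    · subst hl
      rw [Pi.single_eq_same, smul_mk, X_mul_cofactor₂' hjk, Ideal.Quotient.eq_zero_iff_mem]
      exact cofactor_mem j
    · rw [Pi.single_eq_of_ne hl, smul_zero])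

/-- `E_{kj}(m_k) = m_{jk}` and `E_{kj}(m_l) = 0` for `l ≠ k`. -/
theorem normalField_gen [IsDomain K] {j k : Fin n} (hjk : j ≠ k) (l : Fin n) :
    normalField hjk ⟨cofactor l, cofactor_mem l⟩
      = if l = k then Ideal.Quotient.mk (srDesignIdeal K n) (cofactor₂ j k) else 0 := by
  rw [normalField, homOfTuple_gen]
  by_cases hl : l = k
  · subst hl; simp
  · simp [hl]

/-! ## Dictionary: `π : Der_K(R) → Hom_R(I_W, R/I_W)`, `π(θ)(f) = θ(f) mod I_W`, on the coordinate fields -/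

/-- `π(θ) : I_W → R/I_W`, `f ↦ θ(f) mod I_W`, for a `K`-derivation `θ` of `R` — `R`-linear because `f ∈ I_W` kills the
Leibniz defect `f · θ(r)`.  (The affine model of `π : T_X → N′_Z` of G2-REDUCIBLE-POINT §1.) -/
noncomputable def derivToNormal (θ : Derivation K (MvPolynomial (Fin n) K) (MvPolynomial (Fin n) K)) :
    srDesignIdeal K n →ₗ[MvPolynomial (Fin n) K] MvPolynomial (Fin n) K ⧸ srDesignIdeal K n where
  toFun f := Ideal.Quotient.mk (srDesignIdeal K n) (θ f.1)
  map_add' f g := by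
    simp only [Submodule.coe_add, map_add]
  map_smul' r f := by
    change Ideal.Quotient.mk _ (θ (r * f.1)) = r • Ideal.Quotient.mk _ (θ f.1)
    rw [Derivation.leibniz, smul_eq_mul, smul_eq_mul, map_add, map_mul, map_mul,
      Ideal.Quotient.eq_zero_iff_mem.2 f.2, zero_mul, add_zero, smul_mk, map_mul]

/-- `π(θ)` on an element of `I_W`. -/
theorem derivToNormal_apply (θ : Derivation K (MvPolynomial (Fin n) K) (MvPolynomial (Fin n) K))
    (f : srDesignIdeal K n) : derivToNormal θ f = Ideal.Quotient.mk (srDesignIdeal K n) (θ f.1) := rfl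

/-- `x_l` does not occur in `m_{lk}`. -/
theorem notMem_vars_cofactor₂ [IsDomain K] (l k : Fin n) : l ∉ (cofactor₂ l k : MvPolynomial (Fin n) K).vars := by
  classical
  intro h
  have h' := vars_prod (fun i => (X i : MvPolynomial (Fin n) K)) h
  rw [Finset.mem_biUnion] at h'
  obtain ⟨i, hi, hli⟩ := h'
  rw [vars_X, Finset.mem_singleton] at hli
  subst hli
  exact Finset.notMem_erase l _ hi

/-- `x_k` does not occur in `m_k`. -/
theorem notMem_vars_cofactor [IsDomain K] (k : Fin n) : k ∉ (cofactor k : MvPolynomial (Fin n) K).vars := by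
  classical
  intro h
  have h' := vars_prod (fun i => (X i : MvPolynomial (Fin n) K)) h
  rw [Finset.mem_biUnion] at h'
  obtain ⟨i, hi, hki⟩ := h'
  rw [vars_X, Finset.mem_singleton] at hki
  subst hki
  exact Finset.notMem_erase k _ hi

/-- `∂_l m_k = m_{lk}` for `l ≠ k`. -/
theorem pderiv_cofactor_of_ne [IsDomain K] {l k : Fin n} (hlk : l ≠ k) :
    pderiv l (cofactor k : MvPolynomial (Fin n) K) = cofactor₂ l k := by
  rw [← X_mul_cofactor₂ hlk, pderiv_mul, pderiv_X_self, one_mul,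
    pderiv_eq_zero_of_notMem_vars (notMem_vars_cofactor₂ l k), mul_zero, add_zero]

/-- `∂_k m_k = 0`. -/
theorem pderiv_cofactor_self [IsDomain K] (k : Fin n) : pderiv k (cofactor k : MvPolynomial (Fin n) K) = 0 :=
  pderiv_eq_zero_of_notMem_vars (notMem_vars_cofactor k)

/-- **`π(∂_l) = Σ_{k ≠ l} E_{kl}`** (G2-REDUCIBLE-POINT §2 L1 (i), last line): the coordinate field `∂_l` goes to the
sum over the branches `B_lk ∋` of their constant normal field in the `x_l`-direction — on generators,
`π(∂_l)(m_k) = m_{lk}` for `k ≠ l` and `π(∂_l)(m_l) = 0`. -/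
theorem derivToNormal_pderiv_gen [IsDomain K] (l k : Fin n) :
    derivToNormal (pderiv l) ⟨cofactor k, cofactor_mem k⟩
      = if l = k then 0 else Ideal.Quotient.mk (srDesignIdeal K n) (cofactor₂ l k) := by
  rw [derivToNormal_apply]
  split_ifs with h
  · subst h
    rw [pderiv_cofactor_self, map_zero]
  · rw [pderiv_cofactor_of_ne h]

/-- The same in terms of the normal fields: `π(∂_l)` and `E_{kl}` agree on `m_k` (`k ≠ l`), and `π(∂_l)(m_l) = 0`;
so under `normalModuleEquiv` the field `π(∂_l)` has component `1` at every `(k, j) = (k, l)`, `k ≠ l`, and `0`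
elsewhere — the projection `T_X|_{B_F} → N_{B_F}` branch by branch. -/
theorem derivToNormal_pderiv_eq_normalField [IsDomain K] {l k : Fin n} (hlk : l ≠ k) :
    derivToNormal (pderiv l) ⟨cofactor k, cofactor_mem k⟩
      = normalField (K := K) hlk ⟨cofactor k, cofactor_mem k⟩ := by
  rw [derivToNormal_pderiv_gen, if_neg hlk, normalField_gen, if_pos rfl]

end Summit.Ventures.HSemireg.ObstructionLocus
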